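import Summits.Ventures.Crystal3D.Theorems.StickyWulffConstantTextureLiminfTentBarlowFrames
import HarnessLib

/-!
# Charge versus flux: a strip-wise dominated charge table is dominated by the two plates' strip fluxes
# (lane T, the T-side port of lane G's walker ledger — flux bookkeeping; crux `TextureLiminf`, stmt-Ventures-19483)

HONEST FRAMING. Venture `Summits/Ventures/Crystal3D` (cell `crystal3d-full`), helper `--supports` the crux
`TextureLiminf` (stmt-Ventures-19483) of `route-Ventures-StickyWulffConstant`, registered line `TexShadow` (v6.6; cf-p1
ROUTE.md §86(26) U / §86(42) AK).  Rung credit only; F-C1 not moved.  Pure measure theory, nothing about packings.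

In `BilayerWallAt` the charge of a table `c` is `Q(c) = Σ'_{(i,j)} c i j · |S ∩ laySlab L₁ s₁ i ∩ laySlab L₂ s₂ j|`
(`S` the unit slice of the cell); the walker families of the two plates deliver starts strip by strip,
`Σ'_i κ₁ i · |S ∩ laySlab L₁ s₁ i|` and `Σ'_j κ₂ j · |S ∩ laySlab L₂ s₂ j|` (`κ = plateFlux`, `…TexShadowFluxDefs`).  Since the
open layer slabs of ONE frame are pairwise disjoint and cover space up to the null union of the layer planes
(`…TentBarlowFrames`: `disjoint_laySlab`, `mem_laySlab_floor`, `volume_iUnion_planes`):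

* `volume_compl_iUnion_laySlab` — `|(⋃_i laySlab L s i)ᶜ| = 0`;
* `measure_eq_tsum_inter_laySlab` — `|T| = Σ'_j |T ∩ laySlab L s j|` for measurable `T`;
* **`charge_le_flux`** — if `0 ≤ c i j ≤ ½ (κ₁ i + κ₂ j)` with `0 ≤ κ ≤ B`, then for every measurable `S` of finite volume
  `2·Q(c) ≤ Σ'_i κ₁ i·|S ∩ laySlab L₁ s₁ i| + Σ'_j κ₂ j·|S ∩ laySlab L₂ s₂ j|` (real `tsum`s of `toReal`s, as in `BilayerWallAt`).
WHAT THIS IS NOT: not the flux count, not the wall law; F-C1 not moved.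
-/

noncomputable section

namespace Summit.Ventures.Crystal3D.Theorems

open MeasureTheory
open scoped ENNReal
open Summit.Ventures.Crystal3D.Cruxes.TextureLiminf.TexShadow (E3 laySlab)
open Summit.Ventures.Crystal3D.TentCertificate (height hB mem_laySlab_floor disjoint_laySlab isOpen_laySlab
  volume_iUnion_planes)

/-- The layer slabs of one frame cover space up to a null set. -/
theorem volume_compl_iUnion_laySlab (L : E3 ≃ₗᵢ[ℝ] E3) (s : E3) : volume (⋃ i : ℤ, laySlab L s i)ᶜ = 0 := by
  refine measure_mono_null (fun y hy => ?_) (volume_iUnion_planes L s)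
  rw [Set.mem_compl_iff, Set.mem_iUnion, not_exists] at hy
  by_contra hne
  rw [Set.mem_iUnion, not_exists] at hne
  exact hy _ (mem_laySlab_floor L s fun k hk => hne k hk)

/-- The layer slabs are measurable. -/
theorem measurableSet_laySlab (L : E3 ≃ₗᵢ[ℝ] E3) (s : E3) (i : ℤ) : MeasurableSet (laySlab L s i) :=
  (isOpen_laySlab L s i).measurableSet

/-- **Slicing a measurable set by the layer slabs of one frame**: `|T| = Σ'_j |T ∩ laySlab L s j|`. -/
theorem measure_eq_tsum_inter_laySlab (L : E3 ≃ₗᵢ[ℝ] E3) (s : E3) (T : Set E3) (hT : MeasurableSet T) :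
    volume T = ∑' j : ℤ, volume (T ∩ laySlab L s j) := by
  have hU : MeasurableSet (⋃ j : ℤ, laySlab L s j) := MeasurableSet.iUnion fun j => measurableSet_laySlab L s j
  have h1 := measure_inter_add_sdiff T hU (μ := volume)
  have h2 : volume (T \ ⋃ j : ℤ, laySlab L s j) = 0 :=
    measure_mono_null (fun y hy => hy.2) (volume_compl_iUnion_laySlab L s)
  have h3 : volume (T ∩ ⋃ j : ℤ, laySlab L s j) = ∑' j : ℤ, volume (T ∩ laySlab L s j) := by
    rw [Set.inter_iUnion]
    exact measure_iUnion (fun i j hij => (disjoint_laySlab L s hij).mono Set.inter_subset_right Set.inter_subset_right)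
      (fun j => hT.inter (measurableSet_laySlab L s j))
  rw [← h1, h2, add_zero, h3]

/-- **Charge versus flux.**  See the module docstring. -/
theorem charge_le_flux (L₁ L₂ : E3 ≃ₗᵢ[ℝ] E3) (s₁ s₂ : E3) (κ₁ κ₂ : ℤ → ℝ) (c : ℤ → ℤ → ℝ) (B : ℝ)
    (hκ₁ : ∀ i, 0 ≤ κ₁ i) (hκ₁B : ∀ i, κ₁ i ≤ B) (hκ₂ : ∀ j, 0 ≤ κ₂ j) (hκ₂B : ∀ j, κ₂ j ≤ B)
    (hc : ∀ i j, 0 ≤ c i j) (hdom : ∀ i j, c i j ≤ (κ₁ i + κ₂ j) / 2)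
    (S : Set E3) (hS : MeasurableSet S) (hSfin : volume S ≠ ⊤) :
    2 * ∑' ij : ℤ × ℤ, c ij.1 ij.2 * (volume (S ∩ laySlab L₁ s₁ ij.1 ∩ laySlab L₂ s₂ ij.2)).toReal ≤
      ∑' i : ℤ, κ₁ i * (volume (S ∩ laySlab L₁ s₁ i)).toReal +
        ∑' j : ℤ, κ₂ j * (volume (S ∩ laySlab L₂ s₂ j)).toReal := by
  -- notation
  set V : ℤ × ℤ → ℝ≥0∞ := fun ij => volume (S ∩ laySlab L₁ s₁ ij.1 ∩ laySlab L₂ s₂ ij.2) with hV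
  set A₁ : ℤ → ℝ≥0∞ := fun i => volume (S ∩ laySlab L₁ s₁ i) with hA₁
  set A₂ : ℤ → ℝ≥0∞ := fun j => volume (S ∩ laySlab L₂ s₂ j) with hA₂
  set C : ℤ × ℤ → ℝ≥0∞ := fun ij => ENNReal.ofReal (c ij.1 ij.2) with hC
  set K₁ : ℤ → ℝ≥0∞ := fun i => ENNReal.ofReal (κ₁ i) with hK₁
  set K₂ : ℤ → ℝ≥0∞ := fun j => ENNReal.ofReal (κ₂ j) with hK₂
  have hB0 : 0 ≤ B := (hκ₁ 0).trans (hκ₁B 0)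
  -- finiteness
  have hVle : ∀ ij, V ij ≤ volume S := fun ij =>
    measure_mono (Set.inter_subset_left.trans Set.inter_subset_left)
  have hVfin : ∀ ij, V ij ≠ ⊤ := fun ij => ne_top_of_le_ne_top hSfin (hVle ij)
  have hA₁fin : ∀ i, A₁ i ≠ ⊤ := fun i => ne_top_of_le_ne_top hSfin (measure_mono Set.inter_subset_left)
  have hA₂fin : ∀ j, A₂ j ≠ ⊤ := fun j => ne_top_of_le_ne_top hSfin (measure_mono Set.inter_subset_left)
  -- slicing identities
  have hE1 : ∀ i, ∑' j, V (i, j) = A₁ i := fun i =>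
    (measure_eq_tsum_inter_laySlab L₂ s₂ (S ∩ laySlab L₁ s₁ i) (hS.inter (measurableSet_laySlab L₁ s₁ i))).symm
  have hE2 : ∀ j, ∑' i, V (i, j) = A₂ j := by
    intro j
    have := measure_eq_tsum_inter_laySlab L₁ s₁ (S ∩ laySlab L₂ s₂ j) (hS.inter (measurableSet_laySlab L₂ s₂ j))
    rw [hA₂]; simp only
    rw [this]
    refine tsum_congr fun i => ?_
    rw [hV]; simp only
    rw [Set.inter_right_comm]
  have hSum₁ : ∑' i, A₁ i = volume S := (measure_eq_tsum_inter_laySlab L₁ s₁ S hS).symm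
  have hSum₂ : ∑' j, A₂ j = volume S := (measure_eq_tsum_inter_laySlab L₂ s₂ S hS).symm
  -- the ENNReal inequality
  have hCK : ∀ ij : ℤ × ℤ, 2 * C ij ≤ K₁ ij.1 + K₂ ij.2 := by
    intro ij
    rw [hC, hK₁, hK₂]; simp only
    rw [← ENNReal.ofReal_ofNat 2, ← ENNReal.ofReal_mul (by norm_num), ← ENNReal.ofReal_add (hκ₁ _) (hκ₂ _)]
    exact ENNReal.ofReal_le_ofReal (by linarith [hdom ij.1 ij.2])
  have henn : 2 * ∑' ij, C ij * V ij ≤ ∑' i, K₁ i * A₁ i + ∑' j, K₂ j * A₂ j := by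
    calc 2 * ∑' ij, C ij * V ij = ∑' ij, (2 * C ij) * V ij := by
          rw [← ENNReal.tsum_mul_left]; exact tsum_congr fun ij => by ring
      _ ≤ ∑' ij : ℤ × ℤ, (K₁ ij.1 + K₂ ij.2) * V ij := ENNReal.tsum_le_tsum fun ij => by gcongr; exact hCK ij
      _ = ∑' ij : ℤ × ℤ, K₁ ij.1 * V ij + ∑' ij : ℤ × ℤ, K₂ ij.2 * V ij := by
          rw [← ENNReal.tsum_add]; exact tsum_congr fun ij => by ring
      _ = ∑' i, K₁ i * A₁ i + ∑' j, K₂ j * A₂ j := by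
          congr 1
          · rw [ENNReal.tsum_prod']
            refine tsum_congr fun i => ?_
            dsimp only
            rw [ENNReal.tsum_mul_left, hE1 i]
          · rw [ENNReal.tsum_prod', ENNReal.tsum_comm]
            refine tsum_congr fun j => ?_
            dsimp only
            rw [ENNReal.tsum_mul_left, hE2 j]
  -- finiteness of the right-hand side
  have hR₁ : ∑' i, K₁ i * A₁ i ≠ ⊤ := by
    have h : ∑' i, K₁ i * A₁ i ≤ ENNReal.ofReal B * volume S := by
      calc ∑' i, K₁ i * A₁ i ≤ ∑' i, ENNReal.ofReal B * A₁ i :=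
            ENNReal.tsum_le_tsum fun i => by gcongr; exact ENNReal.ofReal_le_ofReal (hκ₁B i)
        _ = ENNReal.ofReal B * volume S := by rw [ENNReal.tsum_mul_left, hSum₁]
    exact ne_top_of_le_ne_top (ENNReal.mul_ne_top ENNReal.ofReal_ne_top hSfin) h
  have hR₂ : ∑' j, K₂ j * A₂ j ≠ ⊤ := by
    have h : ∑' j, K₂ j * A₂ j ≤ ENNReal.ofReal B * volume S := by
      calc ∑' j, K₂ j * A₂ j ≤ ∑' j, ENNReal.ofReal B * A₂ j :=
            ENNReal.tsum_le_tsum fun j => by gcongr; exact ENNReal.ofReal_le_ofReal (hκ₂B j)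
        _ = ENNReal.ofReal B * volume S := by rw [ENNReal.tsum_mul_left, hSum₂]
    exact ne_top_of_le_ne_top (ENNReal.mul_ne_top ENNReal.ofReal_ne_top hSfin) h
  -- back to the reals
  have hL : ∑' ij : ℤ × ℤ, c ij.1 ij.2 * (volume (S ∩ laySlab L₁ s₁ ij.1 ∩ laySlab L₂ s₂ ij.2)).toReal =
      (∑' ij, C ij * V ij).toReal := by
    rw [ENNReal.tsum_toReal_eq fun ij => ENNReal.mul_ne_top ENNReal.ofReal_ne_top (hVfin ij)]
    refine tsum_congr fun ij => ?_
    rw [ENNReal.toReal_mul, ENNReal.toReal_ofReal (hc _ _)]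
  have hR₁' : ∑' i : ℤ, κ₁ i * (volume (S ∩ laySlab L₁ s₁ i)).toReal = (∑' i, K₁ i * A₁ i).toReal := by
    rw [ENNReal.tsum_toReal_eq fun i => ENNReal.mul_ne_top ENNReal.ofReal_ne_top (hA₁fin i)]
    refine tsum_congr fun i => ?_
    rw [ENNReal.toReal_mul, ENNReal.toReal_ofReal (hκ₁ _)]
  have hR₂' : ∑' j : ℤ, κ₂ j * (volume (S ∩ laySlab L₂ s₂ j)).toReal = (∑' j, K₂ j * A₂ j).toReal := by
    rw [ENNReal.tsum_toReal_eq fun j => ENNReal.mul_ne_top ENNReal.ofReal_ne_top (hA₂fin j)]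
    refine tsum_congr fun j => ?_
    rw [ENNReal.toReal_mul, ENNReal.toReal_ofReal (hκ₂ _)]
  rw [hL, hR₁', hR₂', ← ENNReal.toReal_add hR₁ hR₂]
  have h2 : (2 : ℝ) * (∑' ij, C ij * V ij).toReal = (2 * ∑' ij, C ij * V ij).toReal := by
    rw [ENNReal.toReal_mul]; norm_num
  rw [h2]
  exact ENNReal.toReal_mono (ENNReal.add_ne_top.2 ⟨hR₁, hR₂⟩) henn

end Summit.Ventures.Crystal3D.Theorems

end
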